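import Summits.Ventures.QEC.CircuitDistance.SyndromeCycle
import HarnessLib
import HarnessLib.Audit.Tags

/-!
# Circuit-level distance CLAIMS of the CDX experiment (venture QEC) — `[[72,12,6]]` and `[[144,12,12]]`

HONEST FRAMING. Nothing in this file asserts a value of `d_circ`: each printed / conjectured value is an
`@[conjecture] def … : Prop` (an obligation node), each pre-registered QUESTION of the cell a plain `def … : Prop`
whose truth value is what the experiment decides (by a kernel-checked certificate in `Theorems/`, or a kernel-checked
explicit fault set). Words of record are the lead's, not this file's.

Source of the claims: [BravyiEtAl2024] (arXiv:2308.07915): p. 7 L52 "We conjecture, based on the numerical simulations,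
that our SM circuit is distance-preserving for the code `[[72,12,6]]`" (`d_circ = d = 6`; Table 1 gives the upper bound
`d_circ ≤ 6`); SI p. 14 L15 "all 936 variants of the syndrome cycle give rise to syndrome measurement circuits with
distance `d_circ ≤ 10` … a specific circuit Eq. (SCunitary_part) which we conjecture to have distance `d_circ = 10`".
For `[[72,12,6]]` the value `6` is moreover CLAIMED IN PRINT by a MaxSAT computation on another compilation of the same
schedule (Beni–Higgott–Shutty, arXiv:2503.10988, App. D) — a sentence, no certificate. The circuits are `bb72SM`,
`bb144SM` of `SyndromeCycle.lean` (labelling of record stated there).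
-/

namespace Summit.Ventures.QEC.CircuitDistance

/-- **CLAIM (print's conjecture, p. 7 L52; value claimed by MaxSAT in arXiv:2503.10988 App. D)** — the depth-7 SM circuit
of `[[72,12,6]]` is distance-preserving: for every number `Nc ≥ 1` of noisy syndrome cycles its circuit-level distance is
exactly `6`. (`≤ 6` for every `Nc ≥ 1` is elementary: a weight-6 `Z`-logical placed on idle data qubits.)
[cite: BravyiEtAl2024, §3 p. 7 L52 and Table 1 row [[72,12,6]]] -/
@[conjecture] def BB72_circuitDistance_eq_six_claim : Prop :=
  ∀ Nc : ℕ, 1 ≤ Nc → circuitDistance bb72SM Nc = 6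

/-- **CDX-Q1 (pre-registered question of the cell)**: is there, for some number of cycles, an undetectable logical fault
set of at most `5` faulty operations in the `[[72,12,6]]` circuit?  (`¬ CDX_Q1 ∧ (≤ 6 witness)` ⟺ the claim above.) -/
def CDX_Q1 : Prop := HasLogicalFaultOfWeightAtMost bb72SM 5

/-- **CLAIM (print's conjecture, SI p. 14 L15)** — the depth-7 SM circuit Eq. (SCunitary_part) of the gross code
`[[144,12,12]]` has circuit-level distance exactly `10` for every number `Nc ≥ 1` of noisy cycles (print: `d_circ ≤ 10` by
BP-OSD for all 936 orderings; `= 10` conjectured for this one; an explicit weight-10 fault set fits in one cycle).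
[cite: BravyiEtAl2024, SI §5 p. 14 L15 and Table 1 row [[144,12,12]]] -/
@[conjecture] def BB144_circuitDistance_eq_ten_claim : Prop :=
  ∀ Nc : ℕ, 1 ≤ Nc → circuitDistance bb144SM Nc = 10

/-- **CDX-Q2 (pre-registered question of the cell, THE target)**: is there, for some number of cycles, an undetectable
logical fault set of at most `9` faulty operations in the `[[144,12,12]]` circuit? -/
def CDX_Q2 : Prop := HasLogicalFaultOfWeightAtMost bb144SM 9

end Summit.Ventures.QEC.CircuitDistance
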